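import Summits.QuantumFields.YangMills.Theorems.ParabolicTrajectoryContinuumLimitOnTrajectoryStubOSLegsA_Lattice
import Literature.MathematicalPhysics.QuantumLattice.SchwingerOSPositivity
import Literature.MathematicalPhysics.QuantumLattice.SchwartzHalfSpaceCutoff

/-!
# Crux `ContinuumLimitOnTrajectory` (stmt-QuantumFields-10522), line `two-orbit-synchronisation` (seat c2):
# the truncated two-block functional and its nine-term expansion

Helper file (`--supports stmt-QuantumFields-10522`) for the registered stub `stub_uclOfGap : UCLOfGap` (skeleton v3.1).
Pure algebra of the clustering leg: the truncated functional of two blocks of test functions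
`covc r sch k X Y = curvDistribution k (n+m) (X ⊗ Y) − curvDistribution k n X · curvDistribution k m Y`
is bi-additive (`curvDistribution` is linear, `⊗` is bilinear), so the three-piece decompositions of the two factors
(window / mid tail / far tail by the half-space cutoffs `cutLE`, `cutGE` of `SchwartzHalfSpaceCutoff`) expand it into nine terms:

* `covc`, `covc_add_left/right`, `covc_sub_left/right`, `norm_covc_sum3_le`;
* `threePieces` — `X = cutGE ρ (cutLE θ X) + cutGE ρ (X − cutLE θ X) + (X − cutGE ρ X)` and its mirror `threePieces'`.

Vocabulary `…StubOSLegsA_Lattice` (`curvDistribution_add/sub`); nothing about Wilson's theory is asserted.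
-/

set_option autoImplicit false

open scoped SchwartzMap
open MeasureTheory Filter Topology
open Literature.MathematicalPhysics.QuantumFieldTheory Literature.MathematicalPhysics.QuantumLattice
open Literature.MathematicalPhysics.AQFT Literature.Probability.LatticeModels

noncomputable section

namespace Summit.QuantumFields.YangMills.Cruxes.ContinuumLimitOnTrajectory.TwoOrbitSynchronisation

local notation "𝔼" => EuclideanSpace ℝ (Fin 4)

variable {G : Type} [Group G] [TopologicalSpace G] [IsTopologicalGroup G] [CompactSpace G]
  [MeasurableSpace G] [BorelSpace G]

/-- **The truncated two-block functional** `cD (X ⊗ Y) − cD X · cD Y` at step `k`. -/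
def covc (r : LatticeRep G) (sch : SpeciesScheme (YMSpecies G)) (k : ℕ) {n m : ℕ} (X : 𝓢((Fin n → 𝔼), ℂ))
    (Y : 𝓢((Fin m → 𝔼), ℂ)) : ℂ :=
  curvDistribution r sch k (n + m) (X.appendTensor Y) - curvDistribution r sch k n X * curvDistribution r sch k m Y

section Bilinear

variable (r : LatticeRep G) (sch : SpeciesScheme (YMSpecies G)) (k : ℕ) {n m : ℕ}

/-- Additivity in the left block. -/
theorem covc_add_left (X X' : 𝓢((Fin n → 𝔼), ℂ)) (Y : 𝓢((Fin m → 𝔼), ℂ)) :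
    covc r sch k (X + X') Y = covc r sch k X Y + covc r sch k X' Y := by
  simp only [covc, SchwartzMap.appendTensor_add_left, curvDistribution_add]
  ring

/-- Additivity in the right block. -/
theorem covc_add_right (X : 𝓢((Fin n → 𝔼), ℂ)) (Y Y' : 𝓢((Fin m → 𝔼), ℂ)) :
    covc r sch k X (Y + Y') = covc r sch k X Y + covc r sch k X Y' := by
  simp only [covc, SchwartzMap.appendTensor_add_right, curvDistribution_add]
  ring

/-- Subtractivity in the left block. -/
theorem covc_sub_left (X X' : 𝓢((Fin n → 𝔼), ℂ)) (Y : 𝓢((Fin m → 𝔼), ℂ)) :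
    covc r sch k (X - X') Y = covc r sch k X Y - covc r sch k X' Y := by
  simp only [covc, SchwartzMap.appendTensor_sub_left, curvDistribution_sub]
  ring

/-- Subtractivity in the right block. -/
theorem covc_sub_right (X : 𝓢((Fin n → 𝔼), ℂ)) (Y Y' : 𝓢((Fin m → 𝔼), ℂ)) :
    covc r sch k X (Y - Y') = covc r sch k X Y - covc r sch k X Y' := by
  simp only [covc, SchwartzMap.appendTensor_sub_right, curvDistribution_sub]
  ring

end Bilinear

/-- **Nine-term bound**: if `X = X₁ + X₂ + X₃` and `Y = Y₁ + Y₂ + Y₃` then `‖covc X Y‖ ≤ ∑ᵢⱼ ‖covc Xᵢ Yⱼ‖` (registered anchor). -/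
theorem norm_covc_sum3_le :
    ∀ {G : Type} [Group G] [TopologicalSpace G] [IsTopologicalGroup G] [CompactSpace G] [MeasurableSpace G] [BorelSpace G]
      (r : LatticeRep G) (sch : SpeciesScheme (YMSpecies G)) (k : ℕ) {n m : ℕ}
      (X₁ X₂ X₃ : 𝓢((Fin n → EuclideanSpace ℝ (Fin 4)), ℂ)) (Y₁ Y₂ Y₃ : 𝓢((Fin m → EuclideanSpace ℝ (Fin 4)), ℂ)),
    ‖covc r sch k (X₁ + X₂ + X₃) (Y₁ + Y₂ + Y₃)‖ ≤
      ‖covc r sch k X₁ Y₁‖ + ‖covc r sch k X₁ Y₂‖ + ‖covc r sch k X₁ Y₃‖ +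
      (‖covc r sch k X₂ Y₁‖ + ‖covc r sch k X₂ Y₂‖ + ‖covc r sch k X₂ Y₃‖) +
      (‖covc r sch k X₃ Y₁‖ + ‖covc r sch k X₃ Y₂‖ + ‖covc r sch k X₃ Y₃‖) := by
  intro G _ _ _ _ _ _ r sch k n m X₁ X₂ X₃ Y₁ Y₂ Y₃
  have h9 : covc r sch k (X₁ + X₂ + X₃) (Y₁ + Y₂ + Y₃) =
      (covc r sch k X₁ Y₁ + covc r sch k X₁ Y₂ + covc r sch k X₁ Y₃) +
      (covc r sch k X₂ Y₁ + covc r sch k X₂ Y₂ + covc r sch k X₂ Y₃) +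
      (covc r sch k X₃ Y₁ + covc r sch k X₃ Y₂ + covc r sch k X₃ Y₃) := by
    simp only [covc_add_left, covc_add_right]; ring
  rw [h9]
  exact norm_add₃_le.trans (add_le_add (add_le_add norm_add₃_le norm_add₃_le) norm_add₃_le)


/-! ## Three-piece decompositions by half-space cutoffs in the time coordinate -/

section Pieces

variable {p : ℕ}

/-- **Window / mid / far decomposition of a LOWER factor**: with an upper cut at `θ` and a lower (far) cut at `ρ`,
`X = cutGE 0 ρ (cutLE 0 θ X) + cutGE 0 ρ (X − cutLE 0 θ X) + (X − cutGE 0 ρ X)`. -/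
theorem threePieces (θ ρ : ℝ) (X : 𝓢((Fin p → 𝔼), ℂ)) :
    X = cutGE 0 ρ (cutLE 0 θ X) + cutGE 0 ρ (X - cutLE 0 θ X) + (X - cutGE 0 ρ X) := by
  rw [map_sub]; abel

/-- **Window / mid / far decomposition of an UPPER factor**: with a lower cut at `θ` and an upper (far) cut at `ρ`,
`Y = cutLE 0 ρ (cutGE 0 θ Y) + cutLE 0 ρ (Y − cutGE 0 θ Y) + (Y − cutLE 0 ρ Y)`. -/
theorem threePieces' (θ ρ : ℝ) (Y : 𝓢((Fin p → 𝔼), ℂ)) :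
    Y = cutLE 0 ρ (cutGE 0 θ Y) + cutLE 0 ρ (Y - cutGE 0 θ Y) + (Y - cutLE 0 ρ Y) := by
  rw [map_sub]; abel

end Pieces

end Summit.QuantumFields.YangMills.Cruxes.ContinuumLimitOnTrajectory.TwoOrbitSynchronisation

end
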